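import Literature.Geometry.Lorentzian.StationaryThetaFormDescent
import Literature.Geometry.Lorentzian.StationaryOrbitRiemannian
import HarnessLib

/-!
# The connection 1-form `ϑ_S` is a `C^∞` 1-form on the orbit manifold
(Anderson 2000, §0, (0.1): the data `(S, g_S, u, θ)` are smooth tensor fields on `S`)

For a bundled four-dimensional chronological stationary spacetime, a `C^∞` time function `t` and
the 1-form `ϑ_S` on the orbit manifold `S` with `ϑ = π^* ϑ_S`
(`StationaryThetaFormDescent.lean`), this file proves that `z ↦ ϑ_S(z)` is a `C^∞` section of the
cotangent bundle `Hom(TS, ℝ)` of `S`: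

* `Spacetime.IsStationaryKilling.contMDiff_oneForm_of_chart` — **a packaging lemma**: a family
  `φ(z) : ℝ³ →L ℝ` on `S` whose coordinate expressions `u ↦ φ(e⁻¹ u)(d(e⁻¹)_u a)` in the slice
  charts `e` are `C^∞` is a `C^∞` section of `Hom(TS, ℝ)` (Mathlib's `contMDiffAt_section`,
  `hom_trivializationAt_apply`, `inCoordinates_eq`, `TangentBundle.symmL_trivializationAt`,
  `contDiffOn_clm_apply`), the 1-form analogue of `contMDiff_quotientMetricCLM`;
* `Spacetime.IsStationaryKilling.thetaFormS_chart_symm` — the coordinate expression of `ϑ_S` in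
  the slice chart with slice `σ` is `u ↦ ϑ_{σ u}(dσ_u a) = A_{σ u}(dσ_u a) − d(t ∘ σ)_u(a)`
  (`ϑ = π^* ϑ_S`);
* `Spacetime.IsStationaryKilling.contMDiffOn_thetaFormS_chart_symm` — it is `C^∞` on the chart
  target (the metric along `σ` on pushed-forward sections, `contMDiffWithinAt_val_apply_along`,
  and the derivative of the `C^∞` function `t ∘ σ`);
* `Spacetime.IsStationaryKilling.contMDiff_thetaFormS` — **`ϑ_S` is a `C^∞` 1-form on `S`.**

Everything is proved; no definitions, no named facts.

## References

* M. T. Anderson, Ann. Henri Poincaré 1 (2000) 977–994, arXiv:gr-qc/0001091, §0, (0.1) (key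
  `Anderson2000`).
-/

noncomputable section

open Bundle Set Filter Function Manifold TopologicalSpace
open scoped ContDiff Topology Manifold

namespace Literature.Geometry.Lorentzian

namespace Spacetime

universe u

variable {𝓢 : Spacetime.{u} 4} [𝓢.metric.HasLeviCivita]
  {X : Π x : 𝓢.carrier, TangentSpace (𝓡 4) x}

/-- `dim ℝ³ + 1 = dim ℝ⁴`. [folklore] -/
private lemma finrank_three_add_one_t :
    Module.finrank ℝ (EuclideanSpace ℝ (Fin 3)) + 1 =
      Module.finrank ℝ (EuclideanSpace ℝ (Fin 4)) := by
  simp [finrank_euclideanSpace]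

/-! ### Packaging: 1-forms on `S` smooth in the slice charts are smooth sections -/

/-- **A 1-form on `S` read in the trivialization at `z₀` is its coordinate expression in the slice
chart at `z₀`**: for `z` in the source of `e = chartAt z₀` and `a ∈ ℝ³`, the section `z ↦ φ(z)` of
`Hom(TS, ℝ)`, trivialized at `z₀` and evaluated at `a`, is `φ(z)(d(e⁻¹)_{e z} a)`. [folklore] -/
theorem IsStationaryKilling.trivializationAt_oneForm (hX : 𝓢.IsStationaryKilling X univ)
    (hchr : 𝓢.metric.IsChronological 𝓢.timeOrientation)
    (φ : OrbitSpace X → (EuclideanSpace ℝ (Fin 3) →L[ℝ] ℝ)) (z₀ : OrbitSpace X) :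
    letI := hX.orbitSpaceChartedSpace hchr
    haveI := (hX.isManifold_orbitSpace hchr).1
    ∀ {z : OrbitSpace X}, z ∈ (chartAt (EuclideanSpace ℝ (Fin 3)) z₀).source →
    ∀ a : EuclideanSpace ℝ (Fin 3),
      (trivializationAt (EuclideanSpace ℝ (Fin 3) →L[ℝ] ℝ)
        (fun z : OrbitSpace X ↦ TangentSpace (𝓡 3) z →L[ℝ] ℝ) z₀ ⟨z, φ z⟩).2 a =
      φ z (mfderiv (𝓡 3) (𝓡 3) (chartAt (EuclideanSpace ℝ (Fin 3)) z₀).symm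
        (chartAt (EuclideanSpace ℝ (Fin 3)) z₀ z) a) := by
  letI := hX.orbitSpaceChartedSpace hchr
  haveI := (hX.isManifold_orbitSpace hchr).1
  intro z hz a
  have hz' : z ∈ (trivializationAt (EuclideanSpace ℝ (Fin 3))
      (TangentSpace (𝓡 3) : OrbitSpace X → Type _) z₀).baseSet := by
    simpa using hz
  have hext : ∀ c : EuclideanSpace ℝ (Fin 3),
      mfderivWithin (𝓡 3) (𝓡 3) (extChartAt (𝓡 3) z₀).symm (range (𝓡 3))
        (extChartAt (𝓡 3) z₀ z) c =
      mfderiv (𝓡 3) (𝓡 3) (chartAt (EuclideanSpace ℝ (Fin 3)) z₀).symm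
        (chartAt (EuclideanSpace ℝ (Fin 3)) z₀ z) c := by
    intro c
    rw [ModelWithCorners.Boundaryless.range_eq_univ, mfderivWithin_univ]
    rfl
  have hsymm : ∀ c : EuclideanSpace ℝ (Fin 3),
      (trivializationAt (EuclideanSpace ℝ (Fin 3)) (TangentSpace (𝓡 3) : OrbitSpace X → Type _)
        z₀).symm z c =
      mfderiv (𝓡 3) (𝓡 3) (chartAt (EuclideanSpace ℝ (Fin 3)) z₀).symm
        (chartAt (EuclideanSpace ℝ (Fin 3)) z₀ z) c := by
    intro c
    rw [← Trivialization.symmL_apply (R := ℝ) _ hz', TangentBundle.symmL_trivializationAt hz]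
    exact hext c
  rw [hom_trivializationAt_apply, ContinuousLinearMap.inCoordinates_eq hz' (by simp)]
  dsimp only
  rw [ContinuousLinearMap.comp_apply, ContinuousLinearMap.comp_apply]
  change ((trivializationAt ℝ (Bundle.Trivial (OrbitSpace X) ℝ) z₀)
    ⟨z, φ z ((trivializationAt (EuclideanSpace ℝ (Fin 3))
      (TangentSpace (𝓡 3) : OrbitSpace X → Type _) z₀).symm z a)⟩).2 = _
  rw [hsymm a]
  rfl

/-- **Packaging lemma: a 1-form on `S` which is `C^∞` in the slice charts is a `C^∞` section of
the cotangent bundle.** If for every `z₀` and `a ∈ ℝ³` the coordinate expression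
`u ↦ φ(e⁻¹ u)(d(e⁻¹)_u a)` (`e = chartAt z₀`) is `C^∞` on `e.target`, then `z ↦ φ(z)` is a `C^∞`
section of `Hom(TS, ℝ)` (Mathlib's `contMDiffAt_section` and `contDiffOn_clm_apply`).
[folklore] -/
theorem IsStationaryKilling.contMDiff_oneForm_of_chart (hX : 𝓢.IsStationaryKilling X univ)
    (hchr : 𝓢.metric.IsChronological 𝓢.timeOrientation)
    (φ : OrbitSpace X → (EuclideanSpace ℝ (Fin 3) →L[ℝ] ℝ)) :
    letI := hX.orbitSpaceChartedSpace hchr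
    haveI := (hX.isManifold_orbitSpace hchr).1
    (∀ (z₀ : OrbitSpace X) (a : EuclideanSpace ℝ (Fin 3)),
      ContMDiffOn (𝓡 3) 𝓘(ℝ, ℝ) ∞
        (fun u ↦ φ ((chartAt (EuclideanSpace ℝ (Fin 3)) z₀).symm u)
          (mfderiv (𝓡 3) (𝓡 3) (chartAt (EuclideanSpace ℝ (Fin 3)) z₀).symm u a))
        (chartAt (EuclideanSpace ℝ (Fin 3)) z₀).target) →
    ContMDiff (𝓡 3) ((𝓡 3).prod 𝓘(ℝ, EuclideanSpace ℝ (Fin 3) →L[ℝ] ℝ)) ∞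
      (fun z ↦ TotalSpace.mk' (EuclideanSpace ℝ (Fin 3) →L[ℝ] ℝ)
        (E := fun z : OrbitSpace X ↦ TangentSpace (𝓡 3) z →L[ℝ] ℝ) z (φ z)) := by
  letI := hX.orbitSpaceChartedSpace hchr
  haveI := (hX.isManifold_orbitSpace hchr).1
  intro hφ z₀
  rw [contMDiffAt_section,
    contMDiffAt_iff_source_of_mem_source (I := 𝓡 3) (mem_chart_source _ z₀),
    ModelWithCorners.Boundaryless.range_eq_univ, contMDiffWithinAt_univ]
  set e := chartAt (EuclideanSpace ℝ (Fin 3)) z₀ with he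
  have hOn : ContMDiffOn 𝓘(ℝ, EuclideanSpace ℝ (Fin 3)) 𝓘(ℝ, EuclideanSpace ℝ (Fin 3) →L[ℝ] ℝ) ∞
      (fun u ↦ (trivializationAt (EuclideanSpace ℝ (Fin 3) →L[ℝ] ℝ)
        (fun z : OrbitSpace X ↦ TangentSpace (𝓡 3) z →L[ℝ] ℝ) z₀
        ⟨(extChartAt (𝓡 3) z₀).symm u, φ ((extChartAt (𝓡 3) z₀).symm u)⟩).2) e.target := by
    rw [contMDiffOn_iff_contDiffOn]
    refine contDiffOn_clm_apply.2 (fun a ↦ ?_)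
    have hsmooth := hφ z₀ a
    rw [contMDiffOn_iff_contDiffOn] at hsmooth
    refine hsmooth.congr (fun u hu ↦ ?_)
    have hzu : (extChartAt (𝓡 3) z₀).symm u ∈ e.source := e.map_target hu
    have key := hX.trivializationAt_oneForm hchr φ z₀ hzu a
    rw [show chartAt (EuclideanSpace ℝ (Fin 3)) z₀ ((extChartAt (𝓡 3) z₀).symm u) = u from
      e.right_inv hu] at key
    exact key
  have hu₀ : extChartAt (𝓡 3) z₀ z₀ ∈ e.target := by
    simpa using e.map_source (mem_chart_source _ z₀)
  exact hOn.contMDiffAt (e.open_target.mem_nhds hu₀)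

/-! ### The coordinate expression of `ϑ_S` in a slice chart -/

/-- **`ϑ_S` in a slice chart**: with slice data `d` at `p` (chart `e`, `e⁻¹ = π ∘ σ`), for
`u ∈ d.dom` and `a ∈ ℝ³`, `ϑ_S(e⁻¹ u)(d(e⁻¹)_u a) = ϑ_{σ u}(dσ_u a)` (`ϑ = π^* ϑ_S` and the chain
rule). [cite: Anderson2000, §0, (0.1)] -/
theorem IsStationaryKilling.thetaFormS_chart_symm (hX : 𝓢.IsStationaryKilling X univ)
    (hchr : 𝓢.metric.IsChronological 𝓢.timeOrientation) {t : 𝓢.carrier → ℝ}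
    (ht : ContMDiff (𝓡 4) 𝓘(ℝ, ℝ) ∞ t) (htθ : ∀ s y, t (hX.flow (s, y)) = t y + s)
    {p : 𝓢.carrier} (d : LorentzianMetric.SliceData X hX.flow (EuclideanSpace ℝ (Fin 3)) p)
    {u : EuclideanSpace ℝ (Fin 3)} (hu : u ∈ d.dom) (a : EuclideanSpace ℝ (Fin 3)) :
    letI := hX.orbitSpaceChartedSpace hchr
    hX.thetaFormS hchr t
        ((d.chart hX.contMDiff_one hX.isMIntegralCurve_flow hX.flow_zero).symm u)
        (mfderiv (𝓡 3) (𝓡 3) (d.chart hX.contMDiff_one hX.isMIntegralCurve_flow hX.flow_zero).symm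
          u a) =
      hX.thetaForm t (d.param u) (mfderiv (𝓡 3) (𝓡 4) d.param u a) := by
  letI := hX.orbitSpaceChartedSpace hchr
  have hfun : ((d.chart hX.contMDiff_one hX.isMIntegralCurve_flow hX.flow_zero).symm :
      EuclideanSpace ℝ (Fin 3) → OrbitSpace X) = orbitProj X ∘ d.param := rfl
  have hπ : MDifferentiableAt (𝓡 4) (𝓡 3) (orbitProj X) (d.param u) :=
    ((hX.contMDiff_orbitProj hchr) _).mdifferentiableAt (by simp)
  have hσ : MDifferentiableAt (𝓡 3) (𝓡 4) d.param u :=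
    (d.contMDiffOn_param.contMDiffAt (d.isOpen_dom.mem_nhds hu)).mdifferentiableAt (by simp)
  rw [hfun, mfderiv_comp u hπ hσ]
  exact (hX.thetaForm_eq_thetaFormS hchr ht htθ (d.param u) _).symm

/-- **The coordinate expression of `ϑ_S` is `C^∞`** on the chart target:
`u ↦ ϑ_{σ u}(dσ_u a) = ⟨X, dσ_u a⟩/⟨X, X⟩ − d(t ∘ σ)_u(a)` with `σ` the `C^∞` slice — the metric on
pushed-forward sections along `σ` (`contMDiffWithinAt_val_apply_along`) and the derivative of the
`C^∞` function `t ∘ σ`. [cite: Anderson2000, §0, (0.1)] -/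
theorem IsStationaryKilling.contMDiffOn_thetaFormS_chart_symm (hX : 𝓢.IsStationaryKilling X univ)
    (hchr : 𝓢.metric.IsChronological 𝓢.timeOrientation) {t : 𝓢.carrier → ℝ}
    (ht : ContMDiff (𝓡 4) 𝓘(ℝ, ℝ) ∞ t) (htθ : ∀ s y, t (hX.flow (s, y)) = t y + s)
    {p : 𝓢.carrier} (d : LorentzianMetric.SliceData X hX.flow (EuclideanSpace ℝ (Fin 3)) p)
    (a : EuclideanSpace ℝ (Fin 3)) :
    letI := hX.orbitSpaceChartedSpace hchr
    ContMDiffOn (𝓡 3) 𝓘(ℝ, ℝ) ∞ (fun u ↦ hX.thetaFormS hchr t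
        ((d.chart hX.contMDiff_one hX.isMIntegralCurve_flow hX.flow_zero).symm u)
        (mfderiv (𝓡 3) (𝓡 3) (d.chart hX.contMDiff_one hX.isMIntegralCurve_flow hX.flow_zero).symm
          u a)) d.dom := by
  letI := hX.orbitSpaceChartedSpace hchr
  -- the two ingredients along the slice: `A(dσ a)` and `dt(dσ a)`
  have hσ := d.contMDiffOn_param
  have hle : (∞ : ℕ∞ω) + 1 ≤ ∞ := by simp
  have hA := contMDiffOn_totalSpace_mfderiv_const d.isOpen_dom hσ hle a
  have hKσ := contMDiffOn_totalSpace_comp hσ hX.isKillingField.contMDiff le_rfl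
  have h1 : ContMDiffOn (𝓡 3) 𝓘(ℝ, ℝ) ∞
      (fun u ↦ 𝓢.metric.val (d.param u) (X (d.param u)) (mfderiv (𝓡 3) (𝓡 4) d.param u a))
      d.dom :=
    fun u hu ↦ 𝓢.metric.toPseudoRiemannianMetric.contMDiffWithinAt_val_apply_along le_rfl
      (hσ u hu) (hKσ u hu) (hA u hu)
  have h2 : ContMDiffOn (𝓡 3) 𝓘(ℝ, ℝ) ∞
      (fun u ↦ 𝓢.metric.val (d.param u) (X (d.param u)) (X (d.param u))) d.dom :=
    fun u hu ↦ 𝓢.metric.toPseudoRiemannianMetric.contMDiffWithinAt_val_apply_along le_rfl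
      (hσ u hu) (hKσ u hu) (hKσ u hu)
  -- `dt(dσ_u a) = d(t ∘ σ)_u a`
  have htσ : ContMDiffOn (𝓡 3) 𝓘(ℝ, ℝ) ∞ (t ∘ d.param) d.dom := ht.comp_contMDiffOn hσ
  have h3 : ContMDiffOn (𝓡 3) 𝓘(ℝ, ℝ) ∞
      (fun u ↦ mvfderiv (𝓡 4) t (d.param u) (mfderiv (𝓡 3) (𝓡 4) d.param u a)) d.dom := by
    have htσ' : ContDiffOn ℝ ∞ (t ∘ d.param) d.dom := (contMDiffOn_iff_contDiffOn).1 htσ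
    have hder : ContDiffOn ℝ ∞ (fun u ↦ fderivWithin ℝ (t ∘ d.param) d.dom u a) d.dom :=
      (htσ'.fderivWithin d.isOpen_dom.uniqueDiffOn (by simp)).clm_apply contDiffOn_const
    rw [contMDiffOn_iff_contDiffOn]
    refine hder.congr (fun u hu ↦ ?_)
    have htd : MDifferentiableAt (𝓡 4) 𝓘(ℝ, ℝ) t (d.param u) := (ht _).mdifferentiableAt (by simp)
    have hσd : MDifferentiableAt (𝓡 3) (𝓡 4) d.param u :=
      (hσ.contMDiffAt (d.isOpen_dom.mem_nhds hu)).mdifferentiableAt (by simp)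
    have hcomp := mfderiv_comp u htd hσd
    have h4 := congrArg (fun L ↦ L a) hcomp
    change mfderiv (𝓡 4) 𝓘(ℝ, ℝ) t (d.param u) (mfderiv (𝓡 3) (𝓡 4) d.param u a) =
      fderivWithin ℝ (t ∘ d.param) d.dom u a
    rw [fderivWithin_of_isOpen d.isOpen_dom hu, ← mfderiv_eq_fderiv]
    exact h4.symm
  -- assemble
  have h5 : ContMDiffOn (𝓡 3) 𝓘(ℝ, ℝ) ∞
      (fun u ↦ hX.thetaForm t (d.param u) (mfderiv (𝓡 3) (𝓡 4) d.param u a)) d.dom := by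
    rw [contMDiffOn_iff_contDiffOn] at h1 h2 h3 ⊢
    have hne : ∀ u ∈ d.dom, 𝓢.metric.val (d.param u) (X (d.param u)) (X (d.param u)) ≠ 0 :=
      fun u _ ↦ (hX.isTimelike (mem_univ _)).1.ne
    refine (((h2.inv hne).mul h1).sub h3).congr (fun u _ ↦ ?_)
    simp only [LorentzianMetric.IsStationaryKilling.thetaForm, sub_apply,
      LorentzianMetric.IsStationaryKilling.connForm_apply]
    rfl
  refine h5.congr (fun u hu ↦ ?_)
  exact hX.thetaFormS_chart_symm hchr ht htθ d hu a

/-- **The connection 1-form `ϑ_S` is a `C^∞` 1-form on the orbit manifold** (a `C^∞` section of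
`Hom(TS, ℝ)`): its coordinate expressions in the slice charts are `C^∞`
(`contMDiffOn_thetaFormS_chart_symm`, `contMDiff_oneForm_of_chart`). With
`contMDiff_quotientMetricCLM` (`g_S`) and `contMDiff_lapse` (`u`), all of Anderson's data
`(S, g_S, u, θ)` of (0.1) are smooth tensor fields on `S`. [cite: Anderson2000, §0, (0.1)] -/
theorem IsStationaryKilling.contMDiff_thetaFormS (hX : 𝓢.IsStationaryKilling X univ)
    (hchr : 𝓢.metric.IsChronological 𝓢.timeOrientation) {t : 𝓢.carrier → ℝ}
    (ht : ContMDiff (𝓡 4) 𝓘(ℝ, ℝ) ∞ t) (htθ : ∀ s y, t (hX.flow (s, y)) = t y + s) :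
    letI := hX.orbitSpaceChartedSpace hchr
    haveI := (hX.isManifold_orbitSpace hchr).1
    ContMDiff (𝓡 3) ((𝓡 3).prod 𝓘(ℝ, EuclideanSpace ℝ (Fin 3) →L[ℝ] ℝ)) ∞
      (fun z ↦ TotalSpace.mk' (EuclideanSpace ℝ (Fin 3) →L[ℝ] ℝ)
        (E := fun z : OrbitSpace X ↦ TangentSpace (𝓡 3) z →L[ℝ] ℝ) z
        (hX.thetaFormS hchr t z)) := by
  letI := hX.orbitSpaceChartedSpace hchr
  haveI := (hX.isManifold_orbitSpace hchr).1
  refine hX.contMDiff_oneForm_of_chart hchr (hX.thetaFormS hchr t) (fun z₀ a ↦ ?_)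
  -- the chart at `z₀` is the slice chart of the chosen slice data at `z₀.out`
  set d : LorentzianMetric.SliceData X hX.flow (EuclideanSpace ℝ (Fin 3)) z₀.out :=
    LorentzianMetric.IsStationaryKilling.sliceDataAt hX hchr (hX.contMDiff_flow.of_le ENat.LEInfty.out)
      hX.flow_zero hX.flow_add hX.isMIntegralCurve_flow finrank_three_add_one_t z₀.out with hd
  exact hX.contMDiffOn_thetaFormS_chart_symm hchr ht htθ d a

end Spacetime

end Literature.Geometry.Lorentzian

end
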